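import Mathlib
import Literature.Computability.Complexity.NullstellensatzRefutation
import Literature.Computability.AlgebraicComplexity.StandardFamilies
import Summits.ValiantsHypothesis.ValiantsHypothesis.Theses.RefutationDegree

/-!
# Bridge: the crux `BeyondHessianNs` from `HasNSRefutationOfDegree` of the defect coefficients
# (line `Sketch`, crux `BeyondHessianNs`)

Helper file for crux item stmt-ValiantsHypothesis-5641 (`RefutationDegree.BeyondHessianNs`).

The route inlines "Rep(n,m) has a Nullstellensatz refutation of degree `≤ D`" as
`∃ h, (∀ μ, deg (h μ · coeff_μ P) ≤ D) ∧ Σ_{μ ∈ supp P} h μ · coeff_μ P = 1` for the defect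
`P = det A(x) - per_n(x)` (a polynomial in `x` with coefficients in the unknown entries).  The tree's
vocabulary is `Literature.Computability.Complexity.HasNSRefutationOfDegree (fun μ ↦ coeff_μ P) D`
(Krajíček's product convention, any finite set of indices).  This file proves the two agree
(`inlined_of_hasNSRefutationOfDegree`, `hasNSRefutationOfDegree_of_inlined`) and packages the
crux as "eventually, `HasNSRefutationOfDegree` of the defect coefficients at size `⌊n²/2⌋ + 1` with
degree `n ^ c`" (`BeyondHessianNs_of_hasNS`, `hasNS_of_BeyondHessianNs`): the form in which every
line of this crux delivers its certificates.
-/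

noncomputable section

-- `Summit.ValiantsHypothesis.ValiantsHypothesis.…` is the tree's mandated single-conjunct layout.
set_option linter.dupNamespace false

namespace Summit.ValiantsHypothesis.ValiantsHypothesis.Theorems.RefutationDegreeBeyondHessianNs

open MvPolynomial
open Literature.Computability.AlgebraicComplexity Literature.Computability.Complexity

section Bridge

variable {K : Type*} [CommRing K] {τ σ : Type*}

/-- From the tree's `HasNSRefutationOfDegree` of the coefficient system of `P` to the route's
inlined form (multipliers indexed by all exponents, summed over `P.support`): extend the
multipliers by `0`; indices outside the support contribute `h μ · 0 = 0`. [folklore] -/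
theorem inlined_of_hasNSRefutationOfDegree (P : MvPolynomial τ (MvPolynomial σ K)) (D : ℕ)
    (h : HasNSRefutationOfDegree (fun μ : τ →₀ ℕ => P.coeff μ) D) :
    ∃ g : (τ →₀ ℕ) → MvPolynomial σ K,
      (∀ μ, (g μ * P.coeff μ).totalDegree ≤ D) ∧ ∑ μ ∈ P.support, g μ * P.coeff μ = 1 := by
  classical
  obtain ⟨s, g, hsum, hdeg⟩ := h
  refine ⟨fun μ => if μ ∈ s then g μ else 0, fun μ => ?_, ?_⟩
  · by_cases hμ : μ ∈ s
    · simpa [hμ] using hdeg μ hμ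
    · simp [hμ]
  · rw [← hsum]
    -- both sums equal the sum over `s ∩ P.support`
    rw [← Finset.sum_filter_add_sum_filter_not P.support (fun μ => μ ∈ s),
      ← Finset.sum_filter_add_sum_filter_not s (fun μ => μ ∈ P.support)]
    have h0 : ∑ μ ∈ P.support.filter (fun μ => ¬ μ ∈ s),
        (if μ ∈ s then g μ else 0) * P.coeff μ = 0 :=
      Finset.sum_eq_zero fun μ hμ => by simp [(Finset.mem_filter.mp hμ).2]
    have h0' : ∑ μ ∈ s.filter (fun μ => ¬ μ ∈ P.support), g μ * P.coeff μ = 0 :=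
      Finset.sum_eq_zero fun μ hμ => by
        rw [notMem_support_iff.mp (Finset.mem_filter.mp hμ).2, mul_zero]
    rw [h0, h0', add_zero, add_zero]
    have hset : P.support.filter (fun μ => μ ∈ s) = s.filter (fun μ => μ ∈ P.support) := by
      ext μ; simp [and_comm]
    rw [hset]
    refine Finset.sum_congr rfl fun μ hμ => ?_
    simp only [if_pos (Finset.mem_filter.mp hμ).1]

/-- Conversely, the route's inlined form is a `HasNSRefutationOfDegree` (take `s = P.support`).
[folklore] -/
theorem hasNSRefutationOfDegree_of_inlined (P : MvPolynomial τ (MvPolynomial σ K)) (D : ℕ)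
    (h : ∃ g : (τ →₀ ℕ) → MvPolynomial σ K,
      (∀ μ, (g μ * P.coeff μ).totalDegree ≤ D) ∧ ∑ μ ∈ P.support, g μ * P.coeff μ = 1) :
    HasNSRefutationOfDegree (fun μ : τ →₀ ℕ => P.coeff μ) D := by
  obtain ⟨g, hdeg, hsum⟩ := h
  exact ⟨P.support, g, hsum, fun μ _ => hdeg μ⟩

end Bridge

/-! ### The crux in `HasNSRefutationOfDegree` form -/

/-- **`BeyondHessianNs` from certificates in tree vocabulary.** If for all `n ≥ n₀` the
coefficient system of the defect `det A(x) - per_n(x)` at size `m = ⌊n²/2⌋ + 1` has a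
Nullstellensatz refutation of degree `≤ n ^ c` (`HasNSRefutationOfDegree`), the crux holds.
[folklore] -/
theorem BeyondHessianNs_of_hasNS (c n₀ : ℕ)
    (H : ∀ n ≥ n₀, HasNSRefutationOfDegree (fun μ : (Fin n × Fin n) →₀ ℕ =>
      ((Matrix.of fun i j : Fin (n ^ 2 / 2 + 1) =>
          MvPolynomial.C (MvPolynomial.X (none, (i, j))) +
            ∑ e : Fin n × Fin n, MvPolynomial.X e * MvPolynomial.C (MvPolynomial.X (some e, (i, j))) :
          Matrix (Fin (n ^ 2 / 2 + 1)) (Fin (n ^ 2 / 2 + 1))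
            (MvPolynomial (Fin n × Fin n)
              (MvPolynomial (Option (Fin n × Fin n) × (Fin (n ^ 2 / 2 + 1) × Fin (n ^ 2 / 2 + 1)))
                ℂ))).det -
        MvPolynomial.map MvPolynomial.C (perPoly (Fin n) ℂ)).coeff μ) (n ^ c)) :
    Summit.ValiantsHypothesis.ValiantsHypothesis.Theses.RefutationDegree.BeyondHessianNs := by
  refine ⟨c, n₀, fun n hn => ?_⟩
  exact inlined_of_hasNSRefutationOfDegree _ _ (H n hn)

/-- Conversely the crux gives `HasNSRefutationOfDegree` of the defect coefficients, eventually.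
[folklore] -/
theorem hasNS_of_BeyondHessianNs
    (H : Summit.ValiantsHypothesis.ValiantsHypothesis.Theses.RefutationDegree.BeyondHessianNs) :
    ∃ c n₀ : ℕ, ∀ n ≥ n₀, HasNSRefutationOfDegree (fun μ : (Fin n × Fin n) →₀ ℕ =>
      ((Matrix.of fun i j : Fin (n ^ 2 / 2 + 1) =>
          MvPolynomial.C (MvPolynomial.X (none, (i, j))) +
            ∑ e : Fin n × Fin n, MvPolynomial.X e * MvPolynomial.C (MvPolynomial.X (some e, (i, j))) :
          Matrix (Fin (n ^ 2 / 2 + 1)) (Fin (n ^ 2 / 2 + 1))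
            (MvPolynomial (Fin n × Fin n)
              (MvPolynomial (Option (Fin n × Fin n) × (Fin (n ^ 2 / 2 + 1) × Fin (n ^ 2 / 2 + 1)))
                ℂ))).det -
        MvPolynomial.map MvPolynomial.C (perPoly (Fin n) ℂ)).coeff μ) (n ^ c) := by
  obtain ⟨c, n₀, h⟩ := H
  exact ⟨c, n₀, fun n hn => hasNSRefutationOfDegree_of_inlined _ _ (h n hn)⟩

end Summit.ValiantsHypothesis.ValiantsHypothesis.Theorems.RefutationDegreeBeyondHessianNs

end
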